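import Summits.QuantumFields.YangMills.Theorems.BalabanUVNodesK1EndOfWindowRunsNoShrinkSurvCont
import Summits.QuantumFields.BalabanUV.Gaps.EndTopRunCriterion

/-!
# Crux K1⁸ ∕ K2⁸ — THE β-BOUND-FREE END CRITERION: on forward-generated, halting, currying constructions whose in-window runs do not cross, and given (C) only,
# `EndpointExistence` ⟺ {RUNS OF EVERY LENGTH IN EVERY SMALL WINDOW ∧ NO BACKSLIDING FROM THE TOP} — Gaps' `EndTopRunCriterion.endpointExistence_iff_topRuns` WITHOUT ITS CEILING

Cell `pub-ymgap`, YM-PLAN Track A (HUMAN RULING D-0062 ∕ D-0149, director-ym №197 ∕ №207), WIDTH SEAT `pub-ymgap-dag-n13-w4` (g6) on NODE n13 [Balaban1989LargeFieldII]; helper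
(`--supports stmt-QuantumFields-26907 --as helper`, count-neutral) for the deciding crux K1⁸ `StabilityBRunRowsAtRecordR13SepCoPH` = stmt-QuantumFields-26907 (route rev 26ᴿ ∕ 27), on the
side of its born-closed partner K2⁸ `EndpointGivenRunRowsR13SepCoPH` = stmt-QuantumFields-26908 (the END road).  Twelfth module of the seat's window ∕ survivor ∕ END lineage; capstone of
files 10 (p617600: rows (i) + no-shrink + (C) ⟹ END; cited) and 11 (p619590: {all-K window runs, no-shrink, (C)} ⟹ END; window runs NECESSARY; imported BY NAME — nothing restated).

THE POINT.  pub-balaban-gaps g1-p3's `Gaps.EndTopRunCriterion` proved the END binder EXACT in run currency — «every small target is an endpoint at every length ⟺ no in-window run that sits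
at the top of the window backslides below a threshold» — for β continuous AND BOUNDED ABOVE (`BetaUpperH β′`) on the boxes, on flows whose in-window runs do not cross.  The ceiling is
consumed there only to make SEEDS (`EndRunwiseShooting.seed_of_upper`).  File 11 replaced the seeds by WINDOW RUNS (IDEA-4 g12's observation) and showed the window-runs letter NECESSARY.
Hence (§1–§2): the criterion holds WITH NO BOUND ON β AT ALL — `BetaUpperH β′` ∕ `0 ≤ β′` dropped, box continuity weakened to survivor continuity (C), the (necessary) window clause moved
to the right-hand side: **`EndpointExistence C ↔ ∃ γ₂ > 0, ∀ γ ∈ ]0,γ₂], (∀ K, ∃ in-]0,γ] solution of (0.20) of length K) ∧ (∃ g⋆ > 0, every in-]0,γ] solution sitting at γ at a step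
k ≤ n ends at g_n ≥ g⋆)`**.  The sufficiency half needs neither the non-crossing nor any floor: window-run seeds + the threshold close the intermediate-value dichotomy in two lines
(`couplingTrajectory_exists_of_windowRuns_topRuns`: the touching run ends at `g⋆ ≤ g_K < g ≤ g⋆`); [III] (2.6)'s no-shrink letter is the LINEAR-threshold instance `g⋆(γ) = γ∕(1+β₀)`
(file 10's `topRuns_of_noShrink`), so file 11's ★★★ factors through §1.  §2 recovers Gaps' criterion as the ceiling instance (a box ceiling produces the window clause,
`windowRuns_of_betaUpperH`).  §3: NODE 00's v1.7 datum HALTS outside (its couplings are `genSeq` with the `solveCoupling` convention — `RGMachineCore.haltsOutside`, as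
`…K2AtRecord13CoreTopRuns.haltsOutside_datumOfRecord₁₃Core` one record edition earlier), so K2⁸'s consequent AT θ is EQUIVALENT to {all-K window runs ∧ thresholds} of `betaOfRecord₁₃ θ`
GIVEN (C) and non-crossing — node O's END bill in exact form, reading no bound on β.

WHAT THIS FILE PROVES (theorems only; 0 `def`, 0 `sorry`, standard axioms).
* §1 ★ `couplingTrajectory_exists_of_windowRuns_topRuns` · `endpointExistence_of_windowRuns_topRuns_betaContH` · ★★ `endpointExistence_of_windowRuns_topRuns_survCont` (file 11's ★★★ =
  this at the linear thresholds of file 10's `topRuns_of_noShrink` — remark, not re-declared).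
* §2 `topRuns_of_endpointExistence` (necessity of the thresholds: gen ∧ halt ∧ cur ∧ non-crossing; Gaps' `le_end_of_topRun`) · ★★★ `endpointExistence_iff_windowRuns_topRuns` ·
  `endpointExistence_modelOf_iff_windowRuns_topRuns` · `windowRuns_of_betaUpperH` · `endpointExistence_iff_topRuns_of_ceiling` (Gaps' criterion re-derived as the ceiling instance).
* §3 `haltsOutside_datumOfRecord₁₃SepCoPH` · ★ `endpointExistence_datumOfRecord₁₃SepCoPH_iff_windowRuns_topRuns` (general `N`).

HONEST SCOPE.  [folklore] real analysis on the recursion (0.20) over the tree's carriers, Gaps' roads BY NAME; every β-side letter (window runs, thresholds, (C), non-crossing, ceilings) is a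
HYPOTHESIS SHAPE — whether `Node00.betaOfRecord₁₃ θ` has (C) or non-crossing in-window runs is NOT asserted (NODE O: [I] Thm 2 p. 259, §1 pp. 263–264, p. 298; [III] (2.6)); nothing of
Bałaban asserted; NOT a proof of any K1 v7ᴿ stub; K1⁸ NOT closed; N13 NOT discharged; counts unmoved (typed 28∕28 · discharged 5∕27 · A 5∕28).  One finite four-torus programme at fixed
`ε = L^{−K}`, Bałaban AS PRINTED; the Yang–Mills mass gap (Clay) is NOT proved by any of this — route R4 closes the conditional finite-𝕋⁴ rung `BalabanLadder.UV` only; nothing continuum ∕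
ℝ⁴ ∕ OS.  No `def`, no `instance`, no `notation`, no `axiom`.
References (context only): [I] = [Balaban1987RG1] CMP **109** (1987): (0.17)–(0.20) pp. 255–256, Thm 2 p. 259, §1 pp. 263–264, §5 p. 298; [III] = [Balaban1988Convergent] CMP **119** (1988):
(2.6) p. 255; [V] = [Balaban1989LargeFieldII] CMP **122** (1989): Thm 1 + (0.1) pp. 355–356.
-/

noncomputable section

open scoped BigOperators Matrix.Norms.L2Operator

namespace Summit.QuantumFields.YangMills.Theorems.BalabanUVNodesK1EndCriterionCeilingFree

open Literature.MathematicalPhysics.QuantumFieldTheory.Balaban1983to89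
open Literature.MathematicalPhysics.QuantumFieldTheory.Balaban1983to89.FlowStep
open Literature.MathematicalPhysics.QuantumFieldTheory.Balaban1983to89.FlowStepRuns
open Literature.MathematicalPhysics.QuantumFieldTheory.Balaban1983to89.DagBinding
open Literature.MathematicalPhysics.QuantumFieldTheory.Balaban1983to89.T4Continuum (T4Family FiniteEpsData)
open Summit.QuantumFields.YangMills.Theorems.BalabanUVNodesK2NamedJetsRunRemAt (Survivors SurvCont)
open Summit.QuantumFields.BalabanUV.Gaps.EndSurvivorExtension (extH betaContH_extH rgEqH_extH_of_rgEqH rgEqH_of_rgEqH_extH)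
open Summit.QuantumFields.BalabanUV.Gaps.EndContAlongFoliation (endpointExistence_of_runs)
open Summit.QuantumFields.BalabanUV.Gaps.EndTopRunCriterion (le_end_of_topRun)
open Summit.QuantumFields.YangMills.Theorems.BalabanUVNodesK1EndOfWindowRunsNoShrinkSurvCont (seed_of_windowRun run_dichotomy_of_seed exists_extension_of_survCont
  windowRuns_of_endpointExistence windowRuns_of_runwiseCeiling)

/-! ## §1 SUFFICIENCY: window-run seeds + a top-run threshold close the shooting — no ceiling, no floor, no order hypothesis -/

section Sufficiency

variable {β : HBeta}

/-- **★ WINDOW RUNS + A TOP-RUN THRESHOLD ⟹ EVERY SMALL TARGET IS HIT EXACTLY, AT EVERY LENGTH.**  `β` continuous on the boxes `]0,γ]^{k+1}`; runs of every length inside `]0, g]` for every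
`g ∈ ]0, γ]` (run currency); a threshold `g⋆ > 0` at level `γ` («every in-]0,γ] solution of (0.20) sitting at `γ` at a step `k ≤ n` ends at `g_n ≥ g⋆`»).  Then for every `K` and every
target `g ∈ ]0, min g⋆ γ]` an in-]0,γ] solution of length `K` ends EXACTLY at `g_K = g`: the seed is the window run inside `]0,g]` (file 11's `seed_of_windowRun`), and the touching alternative
of the dichotomy (`run_dichotomy_of_seed`) would end at `g⋆ ≤ g_K < g ≤ g⋆`.  Compare Gaps' `EndTopRunCriterion.reachable_iff_topRuns` (⟸), which needs the ceiling `β ≤ β′` for its seed.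
[cite: Balaban1987RG1, Thm 2 p.259 (first sentence), (0.17)–(0.20) pp.255–256 (elementary consequence; nothing of the theorem asserted)] -/
theorem couplingTrajectory_exists_of_windowRuns_topRuns (β : HBeta) {γ gstar : ℝ} (hγ : 0 < γ) (hcont : BetaContH γ β)
    (hwin : ∀ g : ℝ, 0 < g → g ≤ γ → ∀ K : ℕ, ∃ gs : ℕ → ℝ, RGEqH K β gs ∧ Step.InInterval g K gs)
    (htop : ∀ (n : ℕ) (gs : ℕ → ℝ), RGEqH n β gs → Step.InInterval γ n gs → ∀ k, k ≤ n → gs k = γ → gstar ≤ gs n) :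
    ∀ (K : ℕ) (g : ℝ), 0 < g → g ≤ min gstar γ → ∃ gs : ℕ → ℝ, gs K = g ∧ RGEqH K β gs ∧ Step.InInterval γ K gs := by
  intro K g hg hgle
  have hgγ : g ≤ γ := hgle.trans (min_le_right _ _)
  have hgstar : g ≤ gstar := hgle.trans (min_le_left _ _)
  obtain ⟨gs₀, hrg₀, hI₀⟩ := hwin g hg hgγ K
  obtain ⟨xs, hxs, hxsg, hsv, hendK⟩ := seed_of_windowRun (β := β) (γ := γ) hgγ hrg₀ hI₀
  rcases run_dichotomy_of_seed hγ hcont K hg hgγ hxs hxsg hsv hendK with h | ⟨gs, hrg, hI, hlt, k, hk, hgk, -⟩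
  · exact h
  · exfalso
    have hend : gstar ≤ gs K := htop K gs hrg hI k hk hgk
    linarith

/-- **THE END FROM WINDOW RUNS + PER-LEVEL THRESHOLDS, BOX-CONTINUITY FORM** (every forward-generated `C`): `β` continuous on the boxes `]0,γ₀]^{k+1}`, runs of every length in every window
`]0,γ]`, `γ ≤ γ₀`, and at every level `γ ∈ ]0, γ′]` (`γ′ ≤ γ₀`) some threshold `g⋆(γ) > 0` ⟹ `EndpointExistence C` (with `γ₂ := γ′`, admissible targets `]0, min g⋆(γ) γ]`).  Forward
uniqueness `FlowStepRuns.flow_eq_of_rgEqH` identifies the run with the construction's flow.  NO bound on β, NO floor, NO order hypothesis.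
[cite: Balaban1987RG1, Thm 2 p.259 (first sentence), (0.17)–(0.20) pp.255–256 (elementary consequence; nothing of the theorem asserted)] -/
theorem endpointExistence_of_windowRuns_topRuns_betaContH {C : B12.Construction} (hgen : ForwardGenerated C β) {γ₀ γ' : ℝ} (hγ' : 0 < γ') (hγ'le : γ' ≤ γ₀)
    (hcont : BetaContH γ₀ β)
    (hwin : ∀ γ : ℝ, 0 < γ → γ ≤ γ₀ → ∀ K : ℕ, ∃ gs : ℕ → ℝ, RGEqH K β gs ∧ Step.InInterval γ K gs)
    (htop : ∀ γ : ℝ, 0 < γ → γ ≤ γ' → ∃ gstar : ℝ, 0 < gstar ∧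
      ∀ (n : ℕ) (gs : ℕ → ℝ), RGEqH n β gs → Step.InInterval γ n gs → ∀ k, k ≤ n → gs k = γ → gstar ≤ gs n) :
    EndpointExistence C := by
  intro m
  refine ⟨γ', hγ', fun γ hγ hγle => ?_⟩
  obtain ⟨gstar, hgstar, htopγ⟩ := htop γ hγ hγle
  refine ⟨min gstar γ, lt_min hgstar hγ, fun g hg hgle K => ?_⟩
  have hγ₀le : γ ≤ γ₀ := hγle.trans hγ'le
  have hcontγ : BetaContH γ β := fun k => (hcont k).mono (box_mono hγ₀le k)
  have hwinγ : ∀ g' : ℝ, 0 < g' → g' ≤ γ → ∀ K : ℕ, ∃ gs : ℕ → ℝ, RGEqH K β gs ∧ Step.InInterval g' K gs :=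
    fun g' hg' hg'le K => hwin g' hg' (hg'le.trans hγ₀le) K
  obtain ⟨gs, hgsK, hrg, hI⟩ := couplingTrajectory_exists_of_windowRuns_topRuns β hγ hcontγ hwinγ htopγ K g hg hgle
  have heq : ∀ k, k ≤ K → (C ⟨K, m, gs 0⟩).flow.g k = gs k :=
    flow_eq_of_rgEqH (C ⟨K, m, gs 0⟩).flow β K (fun k hk => hgen.2 ⟨K, m, gs 0⟩ k hk) (hgen.1 ⟨K, m, gs 0⟩) hrg (fun k hk => (hI k hk).1)
  refine ⟨gs 0, fun k hk => ?_, ?_⟩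
  · rw [heq k hk]; exact hI k hk
  · rw [heq K le_rfl]; exact hgsK

/-- **★★ THE END FROM WINDOW RUNS + PER-LEVEL THRESHOLDS + (C), SURVIVOR FORM** (every forward-generated `C`): survivor continuity `SurvCont β γ₀`, runs of every length in every window
`]0,γ]`, `γ ≤ γ₀`, and thresholds at every level `≤ γ′` (`0 < γ′ ≤ γ₀`) ⟹ `EndpointExistence C`.  Tietze unbounded (file 11's `exists_extension_of_survCont`) + `extH` (same in-window runs:
the window runs transfer by `rgEqH_extH_of_rgEqH`, the thresholds by `rgEqH_of_rgEqH_extH`) + `EndContAlongFoliation.endpointExistence_of_runs`.  NO bound on β, NO floor, NO order hypothesis.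
[cite: Balaban1987RG1, Thm 2 p.259 (first sentence), (0.17)–(0.20) pp.255–256, §1 pp.263–264 (elementary consequence; nothing of the theorem asserted)] -/
theorem endpointExistence_of_windowRuns_topRuns_survCont {C : B12.Construction} (hgen : ForwardGenerated C β) {γ₀ γ' : ℝ} (hγ₀ : 0 < γ₀) (hγ' : 0 < γ')
    (hγ'le : γ' ≤ γ₀)
    (hwin : ∀ γ : ℝ, 0 < γ → γ ≤ γ₀ → ∀ K : ℕ, ∃ gs : ℕ → ℝ, RGEqH K β gs ∧ Step.InInterval γ K gs)
    (htop : ∀ γ : ℝ, 0 < γ → γ ≤ γ' → ∃ gstar : ℝ, 0 < gstar ∧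
      ∀ (n : ℕ) (gs : ℕ → ℝ), RGEqH n β gs → Step.InInterval γ n gs → ∀ k, k ≤ n → gs k = γ → gstar ≤ gs n)
    (hsc : SurvCont β γ₀) : EndpointExistence C := by
  obtain ⟨F, hFc, hagree⟩ := exists_extension_of_survCont hsc
  have hwin' : ∀ γ : ℝ, 0 < γ → γ ≤ γ₀ → ∀ K : ℕ, ∃ gs : ℕ → ℝ, RGEqH K (extH F) gs ∧ Step.InInterval γ K gs := by
    intro γ hγ hγle K
    obtain ⟨gs, hrg, hI⟩ := hwin γ hγ hγle K
    exact ⟨gs, rgEqH_extH_of_rgEqH hγle hagree hrg hI, hI⟩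
  have htop' : ∀ γ : ℝ, 0 < γ → γ ≤ γ' → ∃ gstar : ℝ, 0 < gstar ∧
      ∀ (n : ℕ) (gs : ℕ → ℝ), RGEqH n (extH F) gs → Step.InInterval γ n gs → ∀ k, k ≤ n → gs k = γ → gstar ≤ gs n := by
    intro γ hγ hγle
    obtain ⟨gstar, hgstar, h⟩ := htop γ hγ hγle
    exact ⟨gstar, hgstar, fun n gs hrg hI k hk hgk => h n gs (rgEqH_of_rgEqH_extH (hγle.trans hγ'le) hagree hrg hI) hI k hk hgk⟩
  exact endpointExistence_of_runs hγ₀ (modelOf_forwardGenerated _) (modelOf_haltsOutside _) (modelOf_curries _) hgen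
    (fun _ _ hγle _ _ hI hrg => rgEqH_of_rgEqH_extH hγle hagree hrg hI)
    (endpointExistence_of_windowRuns_topRuns_betaContH (modelOf_forwardGenerated (extH F)) hγ' hγ'le (betaContH_extH hFc) hwin' htop')

/- REMARK (no theorem — `dedup.landed`): no-(1+β₀)⁻¹-shrink on `]0,γ′]` ([III] (2.6), last member) IS the family of LINEAR thresholds `g⋆(γ) = γ∕(1+β₀)`, `γ ≤ γ′` (file 10's
`topRuns_of_noShrink`), so file 11's ★★★ `endpointExistence_of_windowRuns_noShrink_survCont` is `endpointExistence_of_windowRuns_topRuns_survCont` at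
`htop := fun γ hγ hγle => ⟨γ / (1 + β₀), div_pos hγ (by linarith), topRuns_of_noShrink hβ₀ hns γ hγ hγle⟩` — the identical statement is already landed (p619590), hence not re-declared here. -/

end Sufficiency

/-! ## §2 EXACTNESS: on non-crossing flows the END implies the thresholds (Gaps' necessity half, no bound ∕ no continuity); the β-bound-free criterion -/

section Criterion

variable {β : HBeta}

/-- **THE END IMPLIES PER-LEVEL TOP-RUN THRESHOLDS** (forward-generated, halting, currying constructions whose in-window runs do NOT CROSS below `γ₀`; no continuity, no bound): below
`min γ₂ γ₀` the END's own endpoint runs reach `g⋆ := min g⋆_END γ` at every length and SOLVE (0.20) (`FlowStepRuns.rgEqH_of_inInterval`), so Gaps' `EndTopRunCriterion.le_end_of_topRun`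
forbids any top run to end below `g⋆`. [cite: Balaban1987RG1, Thm 2 p.259 (first sentence), (0.20) p.256 (bookkeeping)] -/
theorem topRuns_of_endpointExistence {C : B12.Construction} (hgen : ForwardGenerated C β) (hhalt : HaltsOutside C β) (hcur : CurriesHBeta C β)
    {γ₀ : ℝ} (hγ₀ : 0 < γ₀)
    (hord : ∀ γ : ℝ, 0 < γ → γ ≤ γ₀ → ∀ (n : ℕ) (gs gs' : ℕ → ℝ), RGEqH n β gs → RGEqH n β gs' →
      Step.InInterval γ n gs → Step.InInterval γ n gs' → gs 0 < gs' 0 → ∀ k, k ≤ n → gs k < gs' k)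
    (hE : EndpointExistence C) :
    ∃ γ₂ : ℝ, 0 < γ₂ ∧ ∀ γ : ℝ, 0 < γ → γ ≤ γ₂ → ∃ gstar : ℝ, 0 < gstar ∧
      ∀ (n : ℕ) (gs : ℕ → ℝ), RGEqH n β gs → Step.InInterval γ n gs → ∀ k, k ≤ n → gs k = γ → gstar ≤ gs n := by
  obtain ⟨γ₂, hγ₂, H⟩ := hE 0
  refine ⟨min γ₂ γ₀, lt_min hγ₂ hγ₀, fun γ hγ hγle => ?_⟩
  obtain ⟨gstar, hgstar, Hg⟩ := H γ hγ (hγle.trans (min_le_left _ _))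
  refine ⟨min gstar γ, lt_min hgstar hγ, fun n gs hrg hI k hk hgk => ?_⟩
  have hreach : ∀ K : ℕ, ∃ gs : ℕ → ℝ, gs K = min gstar γ ∧ RGEqH K β gs ∧ Step.InInterval γ K gs := by
    intro K
    obtain ⟨g0, hIK, hK⟩ := Hg (min gstar γ) (lt_min hgstar hγ) (min_le_left _ _) K
    exact ⟨(C ⟨K, 0, g0⟩).flow.g, hK, rgEqH_of_inInterval hgen hhalt hcur ⟨K, 0, g0⟩ hIK, hIK⟩
  exact le_end_of_topRun (hord γ hγ (hγle.trans (min_le_right _ _))) hreach hrg hI hk hgk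

/-- **★★★ THE β-BOUND-FREE END CRITERION.**  `C` forward-generated, halting, currying (the three modelling clauses of `FlowStepRuns`, met by `modelOf β`); survivor continuity (C) `SurvCont β γ₀`;
in-window runs of (0.20) non-crossing at every level `≤ γ₀`.  Then `EndpointExistence C ↔ ∃ γ₂ > 0, ∀ γ ∈ ]0,γ₂], (∀ K, ∃ in-]0,γ] solution of (0.20) of length K) ∧
(∃ g⋆ > 0, every in-]0,γ] solution sitting at γ at a step k ≤ n has g_n ≥ g⋆)`.  ⟹: file 11's `windowRuns_of_endpointExistence` and `topRuns_of_endpointExistence` (non-crossing used only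
here); ⟸: §1's survivor form at the levels `≤ min γ₂ γ₀` (Tietze at `γ₀`, box form for `extH F` by restriction) — no bound, no floor.  Gaps' `endpointExistence_iff_topRuns` is the instance
under a box ceiling (below).  On Bałaban's data every hypothesis is NODE O's (not asserted).
[cite: Balaban1987RG1, Thm 2 p.259 (first sentence), (0.17)–(0.20) pp.255–256, §1 pp.263–264, §5 p.298 (elementary; nothing of the theorem asserted)] -/
theorem endpointExistence_iff_windowRuns_topRuns {C : B12.Construction} (hgen : ForwardGenerated C β) (hhalt : HaltsOutside C β) (hcur : CurriesHBeta C β)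
    {γ₀ : ℝ} (hγ₀ : 0 < γ₀) (hsc : SurvCont β γ₀)
    (hord : ∀ γ : ℝ, 0 < γ → γ ≤ γ₀ → ∀ (n : ℕ) (gs gs' : ℕ → ℝ), RGEqH n β gs → RGEqH n β gs' →
      Step.InInterval γ n gs → Step.InInterval γ n gs' → gs 0 < gs' 0 → ∀ k, k ≤ n → gs k < gs' k) :
    EndpointExistence C ↔
      ∃ γ₂ : ℝ, 0 < γ₂ ∧ ∀ γ : ℝ, 0 < γ → γ ≤ γ₂ →
        (∀ K : ℕ, ∃ gs : ℕ → ℝ, RGEqH K β gs ∧ Step.InInterval γ K gs) ∧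
        ∃ gstar : ℝ, 0 < gstar ∧ ∀ (n : ℕ) (gs : ℕ → ℝ), RGEqH n β gs → Step.InInterval γ n gs → ∀ k, k ≤ n → gs k = γ → gstar ≤ gs n := by
  constructor
  · intro hE
    obtain ⟨γw, hγw, Hw⟩ := windowRuns_of_endpointExistence hgen hhalt hcur hE
    obtain ⟨γt, hγt, Ht⟩ := topRuns_of_endpointExistence hgen hhalt hcur hγ₀ hord hE
    exact ⟨min γw γt, lt_min hγw hγt, fun γ hγ hγle =>
      ⟨Hw γ hγ (hγle.trans (min_le_left _ _)), Ht γ hγ (hγle.trans (min_le_right _ _))⟩⟩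
  · rintro ⟨γ₂, hγ₂, H⟩
    -- Tietze at `γ₀`; box form for `extH F` at the level `γ₁ := min γ₂ γ₀` (window runs and thresholds below `γ₁` transfer to `extH F`); transfer back to `C`.
    obtain ⟨F, hFc, hagree⟩ := exists_extension_of_survCont hsc
    set γ₁ : ℝ := min γ₂ γ₀ with hγ₁
    have hγ₁pos : 0 < γ₁ := lt_min hγ₂ hγ₀
    have hγ₁le₀ : γ₁ ≤ γ₀ := min_le_right _ _
    have hwin' : ∀ γ : ℝ, 0 < γ → γ ≤ γ₁ → ∀ K : ℕ, ∃ gs : ℕ → ℝ, RGEqH K (extH F) gs ∧ Step.InInterval γ K gs := by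
      intro γ hγ hγle K
      obtain ⟨gs, hrg, hI⟩ := (H γ hγ (hγle.trans (min_le_left _ _))).1 K
      exact ⟨gs, rgEqH_extH_of_rgEqH (hγle.trans hγ₁le₀) hagree hrg hI, hI⟩
    have htop' : ∀ γ : ℝ, 0 < γ → γ ≤ γ₁ → ∃ gstar : ℝ, 0 < gstar ∧
        ∀ (n : ℕ) (gs : ℕ → ℝ), RGEqH n (extH F) gs → Step.InInterval γ n gs → ∀ k, k ≤ n → gs k = γ → gstar ≤ gs n := by
      intro γ hγ hγle
      obtain ⟨gstar, hgstar, h⟩ := (H γ hγ (hγle.trans (min_le_left _ _))).2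
      exact ⟨gstar, hgstar, fun n gs hrg hI k hk hgk => h n gs (rgEqH_of_rgEqH_extH (hγle.trans hγ₁le₀) hagree hrg hI) hI k hk hgk⟩
    have hcont₁ : BetaContH γ₁ (extH F) := fun k => (betaContH_extH hFc k).mono (box_mono hγ₁le₀ k)
    have hwin₁ : ∀ γ : ℝ, 0 < γ → γ ≤ γ₁ → ∀ K : ℕ, ∃ gs : ℕ → ℝ, RGEqH K (extH F) gs ∧ Step.InInterval γ K gs := hwin'
    exact endpointExistence_of_runs hγ₀ (modelOf_forwardGenerated _) (modelOf_haltsOutside _) (modelOf_curries _) hgen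
      (fun _ _ hγle _ _ hI hrg => rgEqH_of_rgEqH_extH hγle hagree hrg hI)
      (endpointExistence_of_windowRuns_topRuns_betaContH (modelOf_forwardGenerated (extH F)) hγ₁pos le_rfl hcont₁ hwin₁ htop')

/-- The criterion at the CANONICAL construction `modelOf β` (modelling clauses by construction), box-continuity form (`SurvCont.of_betaContH`).
[cite: Balaban1987RG1, Thm 2 p.259 (first sentence), (0.17)–(0.20) pp.255–256] -/
theorem endpointExistence_modelOf_iff_windowRuns_topRuns (β : HBeta) {γ₀ : ℝ} (hγ₀ : 0 < γ₀) (hcont : BetaContH γ₀ β)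
    (hord : ∀ γ : ℝ, 0 < γ → γ ≤ γ₀ → ∀ (n : ℕ) (gs gs' : ℕ → ℝ), RGEqH n β gs → RGEqH n β gs' →
      Step.InInterval γ n gs → Step.InInterval γ n gs' → gs 0 < gs' 0 → ∀ k, k ≤ n → gs k < gs' k) :
    EndpointExistence (modelOf β) ↔
      ∃ γ₂ : ℝ, 0 < γ₂ ∧ ∀ γ : ℝ, 0 < γ → γ ≤ γ₂ →
        (∀ K : ℕ, ∃ gs : ℕ → ℝ, RGEqH K β gs ∧ Step.InInterval γ K gs) ∧
        ∃ gstar : ℝ, 0 < gstar ∧ ∀ (n : ℕ) (gs : ℕ → ℝ), RGEqH n β gs → Step.InInterval γ n gs → ∀ k, k ≤ n → gs k = γ → gstar ≤ gs n :=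
  endpointExistence_iff_windowRuns_topRuns (modelOf_forwardGenerated β) (modelOf_haltsOutside β) (modelOf_curries β) hγ₀ (SurvCont.of_betaContH hγ₀ hcont) hord

/-- **A BOX CEILING PRODUCES THE WINDOW CLAUSE**: `BetaUpperH β′ γ₀ β` is a run-wise ceiling along the in-window runs (their prefixes lie in the boxes), hence gives runs of every length in every
window `]0,γ]`, `γ ≤ γ₀` (file 11's `windowRuns_of_runwiseCeiling`, this lineage's file 8 underneath). [cite: Balaban1987RG1, §1 (1.22) p.264, (0.17)–(0.20) pp.255–256 (elementary consequence)] -/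
theorem windowRuns_of_betaUpperH {β' γ₀ : ℝ} (hhi : BetaUpperH β' γ₀ β) :
    ∀ γ : ℝ, 0 < γ → γ ≤ γ₀ → ∀ K : ℕ, ∃ gs : ℕ → ℝ, RGEqH K β gs ∧ Step.InInterval γ K gs :=
  windowRuns_of_runwiseCeiling (u := fun _ => β') fun _ gs _ hI k hk =>
    hhi k (prefixOf gs k) (mem_box.mpr fun i =>
      ⟨(hI i ((Nat.lt_succ_iff.mp i.isLt).trans hk)).1, (hI i ((Nat.lt_succ_iff.mp i.isLt).trans hk)).2⟩)

/-- **GAPS' CRITERION AS THE CEILING INSTANCE** (sanity; = `EndTopRunCriterion.endpointExistence_iff_topRuns`'s statement, re-derived): under a box ceiling the window clause of the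
β-bound-free criterion is automatic (`windowRuns_of_betaUpperH`), leaving «no backsliding from the top» alone on the right. [cite: Balaban1987RG1, Thm 2 p.259 (first sentence), §1 (1.22) p.264] -/
theorem endpointExistence_iff_topRuns_of_ceiling {C : B12.Construction} (hgen : ForwardGenerated C β) (hhalt : HaltsOutside C β) (hcur : CurriesHBeta C β)
    {γ₀ β' : ℝ} (hγ₀ : 0 < γ₀) (hcont : BetaContH γ₀ β) (hhi : BetaUpperH β' γ₀ β)
    (hord : ∀ γ : ℝ, 0 < γ → γ ≤ γ₀ → ∀ (n : ℕ) (gs gs' : ℕ → ℝ), RGEqH n β gs → RGEqH n β gs' →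
      Step.InInterval γ n gs → Step.InInterval γ n gs' → gs 0 < gs' 0 → ∀ k, k ≤ n → gs k < gs' k) :
    EndpointExistence C ↔
      ∃ γ₂ : ℝ, 0 < γ₂ ∧ ∀ γ : ℝ, 0 < γ → γ ≤ γ₂ → ∃ gstar : ℝ, 0 < gstar ∧
        ∀ (n : ℕ) (gs : ℕ → ℝ), RGEqH n β gs → Step.InInterval γ n gs → ∀ k, k ≤ n → gs k = γ → gstar ≤ gs n := by
  refine (endpointExistence_iff_windowRuns_topRuns hgen hhalt hcur hγ₀ (SurvCont.of_betaContH hγ₀ hcont) hord).trans ⟨?_, ?_⟩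
  · rintro ⟨γ₂, hγ₂, H⟩
    exact ⟨γ₂, hγ₂, fun γ hγ hγle => (H γ hγ hγle).2⟩
  · rintro ⟨γ₂, hγ₂, H⟩
    exact ⟨min γ₂ γ₀, lt_min hγ₂ hγ₀, fun γ hγ hγle =>
      ⟨windowRuns_of_betaUpperH hhi γ hγ (hγle.trans (min_le_right _ _)), H γ hγ (hγle.trans (min_le_left _ _))⟩⟩

end Criterion

/-! ## §3 At NODE 00's v1.7 record datum (general `N`): the datum halts outside, so K2⁸'s consequent AT θ is exactly {all-K window runs ∧ thresholds} given (C) and non-crossing -/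

section Datum

variable {F : T4Family} {N : ℕ} [NeZero N]

/-- **`HaltsOutside` AT THE v1.7 RECORD DATUM**: the datum of record is `datumOfTower` over the Stage-13 core `coreOfRecord₁₃CoPH θ` and the tower `towerOfRecord₁₃SepCoPH θ h` (def-T
`Node00/Record13SepCoPH`), whose couplings are `genSeq` with the `solveCoupling` convention — `RGMachineCore.haltsOutside` (as `…K2AtRecord13CoreTopRuns.haltsOutside_datumOfRecord₁₃Core` at
the Core edition; = dag-n26's `…N26AtRecord13CoPH.haltsOutside_datumOfRecord₁₃CoPH F N θ h.toCore` through the `rfl` bridge `Node00.datumOfRecord₁₃SepCoPH_eq_coPH` — nearest prior art, cited;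
one line either way).  Third modelling clause of `FlowStepRuns` at NODE 00's datum; the other two are its fields `fwd` ∕ `curries`. [cite: Balaban1987RG1, (0.18)–(0.20) pp.255–256 (bookkeeping: the coupling recursion of record)] -/
theorem haltsOutside_datumOfRecord₁₃SepCoPH (θ : Node00.Stage13HParams F N) (h : θ.Provisos₁₃SepCoPH F N) :
    HaltsOutside (Node00.datumOfRecord₁₃SepCoPH F N θ h).C.toB12 (Node00.betaOfRecord₁₃ F N θ.toStage13Params) :=
  (Node00.coreOfRecord₁₃CoPH F N θ).haltsOutside (Node00.towerOfRecord₁₃SepCoPH F N θ h).ρ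

/-- **★ K2⁸'s CONSEQUENT AT θ IN EXACT FORM**: at every Stage-13 tuple `θ` with provisos `h`, GIVEN survivor continuity (C) of `β_θ := betaOfRecord₁₃ F N θ.toStage13Params` at a level
`γ₀ > 0` and non-crossing of its in-window (0.20)-runs below `γ₀` (both NODE O's letters, not asserted), `EndpointExistence (datum).C.toB12 ↔ ∃ γ₂ > 0, ∀ γ ∈ ]0,γ₂], (runs of every
length in ]0,γ]) ∧ (a top-run threshold at γ)` — NO bound on `β_θ` of any kind.  The datum's `fwd` ∕ `curries` fields and `haltsOutside_datumOfRecord₁₃SepCoPH` discharge the modelling clauses.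
[cite: Balaban1987RG1, Thm 2 p.259 (first sentence), (0.17)–(0.20) pp.255–256, §1 pp.263–264, §5 p.298; Balaban1989LargeFieldII, Thm 1 + (0.1) pp.355–356 (bookkeeping)] -/
theorem endpointExistence_datumOfRecord₁₃SepCoPH_iff_windowRuns_topRuns (θ : Node00.Stage13HParams F N) (h : θ.Provisos₁₃SepCoPH F N)
    {γ₀ : ℝ} (hγ₀ : 0 < γ₀) (hsc : SurvCont (Node00.betaOfRecord₁₃ F N θ.toStage13Params) γ₀)
    (hord : ∀ γ : ℝ, 0 < γ → γ ≤ γ₀ → ∀ (n : ℕ) (gs gs' : ℕ → ℝ), RGEqH n (Node00.betaOfRecord₁₃ F N θ.toStage13Params) gs →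
      RGEqH n (Node00.betaOfRecord₁₃ F N θ.toStage13Params) gs' → Step.InInterval γ n gs → Step.InInterval γ n gs' → gs 0 < gs' 0 → ∀ k, k ≤ n → gs k < gs' k) :
    EndpointExistence (Node00.datumOfRecord₁₃SepCoPH F N θ h).C.toB12 ↔
      ∃ γ₂ : ℝ, 0 < γ₂ ∧ ∀ γ : ℝ, 0 < γ → γ ≤ γ₂ →
        (∀ K : ℕ, ∃ gs : ℕ → ℝ, RGEqH K (Node00.betaOfRecord₁₃ F N θ.toStage13Params) gs ∧ Step.InInterval γ K gs) ∧
        ∃ gstar : ℝ, 0 < gstar ∧ ∀ (n : ℕ) (gs : ℕ → ℝ), RGEqH n (Node00.betaOfRecord₁₃ F N θ.toStage13Params) gs → Step.InInterval γ n gs →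
          ∀ k, k ≤ n → gs k = γ → gstar ≤ gs n :=
  endpointExistence_iff_windowRuns_topRuns (Node00.datumOfRecord₁₃SepCoPH F N θ h).fwd (haltsOutside_datumOfRecord₁₃SepCoPH θ h)
    (Node00.datumOfRecord₁₃SepCoPH F N θ h).curries hγ₀ hsc hord

end Datum

end Summit.QuantumFields.YangMills.Theorems.BalabanUVNodesK1EndCriterionCeilingFree

end
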